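import Summits.NavierStokesRegularity.FluidComputer.EulerRateInequality
import Summits.NavierStokesRegularity.FluidComputer.PowerComparison
import Summits.NavierStokesRegularity.FluidComputer.HomSobolev32Clock
import HarnessLib

/-!
# Fluid computer — L59: the `Ḣ^s` rows ABOVE `s = 5/2` at Robinson–Sadowski–Silva's rate `2s/5`, with NO viscosity:
# `‖u(t)‖_{Ḣ^s} ≥ c_s ‖u(t)‖₂^{−(2s−5)/5} (T − t)^{−2s/5}`

HONEST FRAMING (cell `pub-fluidc`, verbatim): *low prior, high value-of-information experiment on Tao's
machine paradigm; NOT a claim that NS blows up.* Theorem side of the cell (the level dictionary); nothing here is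
evidence of blow-up — necessities for EVERY maximal smooth finite-energy solution on `ℝ³`.

Above `s = 5/2` the dictionary had Benameur's exponent `s/3` (L54/L54-H). Robinson–Sadowski–Silva 2012, §VI (6.1),
prove the better rate `2s/5` by an argument that DISCARDS THE VISCOSITY: `½ d/dt ‖u‖²_{Ḣ^s} ≤ c‖u‖²_{Ḣ^s} ∫|ξ||û|`
(their (3.6)) and the interpolation `∫|ξ||û| ≤ c ‖u‖₂^{1−5/(2s)} ‖u‖_{Ḣ^s}^{5/(2s)}` (their (3.10)) give the Riccati law
`y' ≲ ‖u‖₂^{1−5/(2s)} y^{1+5/(4s)}` for `y = ‖u‖²_{Ḣ^s}`. The tree now has both ingredients in dyadic currency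
(`LipschitzSummation`, `LipschitzRowInterpolation`, assembled in `EulerRateInequality.row_two_point_high`), whence:

* `row_clock_high` (**L59 — THE HIGH ROWS, `κ > 5`**) — one `c = c_κ > 0` with
  `c (T − t)^{−2κ/5} ≤ ‖u(t)‖₂^{(2κ−10)/5} · ∑_j 2^{κj} ‖Δ̇_j u(t)‖₂²` at EVERY `t ∈ (0, T)` (the comparison
  `PowerComparison.rpow_mul_le_of_rpow` with `q = 5/(2κ)` run from `t` on `Y + ε`, against `HighRows.exists_row_gt`);
* `homSobolev_clock_high_sq`, `homSobolev_clock_high` (**L59 IN `Ḣ^s`, `s > 5/2`**) —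
  `c_s (T − t)^{−2s/5} ≤ ‖u(t)‖₂^{(2s−5)/5} · ‖u(t)‖_{Ḣ^s}`, i.e. `‖u(t)‖_{Ḣ^s} ≥ c_s ‖u(t)‖₂^{(5−2s)/5} (T−t)^{−2s/5}` —
  Robinson–Sadowski–Silva's (6.1) VERBATIM (their `‖u(T−t)‖_{L²}` factor included); `homSobolev_clock_high_datum` — the
  same with the datum's energy `‖u(0)‖₂`; `homSobolev_clock_high_of_cascadeWitness` — the interface reading.

WHAT IS NEW FOR THE DICTIONARY: (i) the rate `2s/5` beats L54-H's `s/3` for every `s > 5/2` and joins continuously the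
optimal `(2s−1)/4` at `s = 5/2` (both `= 1`); (ii) NO `ν` APPEARS — the constant depends on `s` alone: this row is an
EULER-STRENGTH necessity (the viscous term was thrown away), unlike every clock L19–L58 (all `∝` positive powers of `ν`).
HONEST: not known to be optimal for `s > 5/2` (the scaling-sharp rate would be `(2s−1)/4 > 2s/5`); constants inexplicit;
class = maximal smooth finite-energy solutions on `ℝ³`, Leray–Hopf from `u(0)`; necessity only. 0 sorry; no definitions;
no named facts.

## References

* J. C. Robinson, W. Sadowski, R. P. Silva, J. Math. Phys. 53 (2012) 115618, Lemma 2.2 (2.3), §VI (6.1)–(6.3).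
  [RobinsonSadowskiSilva2012]
* J. Benameur, J. Math. Anal. Appl. 371 (2010) 719–727, Thm. 1.1 (the rate `s/3`). [Benameur2010]
-/

noncomputable section

open MeasureTheory Set Function Filter Topology
open scoped ENNReal NNReal
open Literature.Analysis.FluidPDE Literature.Analysis.FunctionSpaces
open Literature.Analysis.FluidPDE.FluidComputer
open Summit.NavierStokesRegularity.NavierStokesRegularity.Theorems.FluidComputer (x5a_of_cascadeWitness')
open Summit.NavierStokesRegularity.FluidComputer.BlockEnergyTransport
open Summit.NavierStokesRegularity.FluidComputer.EulerRateInequality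
open Summit.NavierStokesRegularity.FluidComputer.PowerComparison
open Summit.NavierStokesRegularity.FluidComputer.HomSobolev32Clock

namespace Summit.NavierStokesRegularity.FluidComputer.EulerRateClock

/-! ## L59: the high rows -/

/-- **L59 — THE HIGH ROWS `κ > 5` AT THE RATE `2κ/5`, VISCOSITY-FREE.** For every `κ > 5` there is `c = c_κ > 0` such
that for every `ν > 0`, `T > 0`, every maximal smooth solution `(u, p)` of the unforced Navier–Stokes system on
`ℝ³ × [0, T)` which is Leray–Hopf from `u 0`, and EVERY `t ∈ (0, T)`:
`c · (T − t)^{−2κ/5} ≤ ‖u(t)‖₂^{(2κ−10)/5} · ∑_{j∈ℤ} 2^{κj} ‖Δ̇_j u(t)‖₂²`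
— i.e. `∑_j 4^{sj} a_j(t)² ≥ c ‖u(t)‖₂^{−(4s−10)/5} (T − t)^{−4s/5}` (`κ = 2s`), the square of Robinson–Sadowski–Silva's
rate for `s > 5/2`, with NO power of `ν`. Proof: the ν-free Riccati law `Y(b) − Y(t) ≤ K ‖u(t)‖₂^{(κ−5)/κ} ∫_t^b Y^{1+q}`
(`q = 5/(2κ)`; `row_two_point_high`, energy non-increasing); were `q L Y(t)^q (T − t) < 1` (`L = K‖u(t)‖₂^{(κ−5)/κ}`),
the comparison `rpow_mul_le_of_rpow` on `Y(t + ·) + ε` would keep `Y` bounded up to `T`, contradicting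
`HighRows.exists_row_gt`; hence `q L Y(t)^q (T − t) ≥ 1`. Necessity only. [cite: RobinsonSadowskiSilva2012, §VI (6.1)–(6.3)] -/
theorem row_clock_high {κ : ℝ} (hκ : 5 < κ) :
    ∃ c : ℝ, 0 < c ∧ ∀ (ν T : ℝ), 0 < ν → 0 < T →
      ∀ (u : ℝ → EuclideanSpace ℝ (Fin 3) → EuclideanSpace ℝ (Fin 3)) (p : ℝ → EuclideanSpace ℝ (Fin 3) → ℝ),
      IsMaximalSmoothSolution ν 0 u p T → IsLerayHopfOn T ν 0 (u 0) u →
      ∀ t ∈ Ioo 0 T,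
        ENNReal.ofReal (c * (T - t) ^ (-(2 * κ / 5))) ≤
          eLpNorm (u t) 2 volume ^ ((2 * κ - 10) / 5) *
            ∑' j : ℤ, (2 : ℝ≥0∞) ^ (κ * (j : ℝ)) * blockL2 (u t) j ^ 2 := by
  obtain ⟨K, hK, hRic⟩ := row_two_point_high hκ
  have hκ0 : 0 < κ := by linarith
  set q : ℝ := 5 / (2 * κ) with hq
  set eκ : ℝ := (κ - 5) / κ with heκ
  have hq0 : 0 < q := by rw [hq]; positivity
  have heκ0 : 0 < eκ := by rw [heκ]; exact div_pos (by linarith) hκ0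
  have hq1 : 1 / q = 2 * κ / 5 := by rw [hq, one_div_div]
  have heq : eκ * (1 / q) = (2 * κ - 10) / 5 := by rw [hq1, heκ]; field_simp; ring
  refine ⟨(q * K) ^ (-(1 / q)), by positivity, fun ν T hν hT u p hmax hLH t₀ ht₀ => ?_⟩
  set Y : ℝ → ℝ := fun τ => (∑' j : ℤ, (2 : ℝ≥0∞) ^ (κ * (j : ℝ)) * blockL2 (u τ) j ^ 2).toReal with hY
  have hY0 : ∀ τ, 0 ≤ Y τ := fun τ => ENNReal.toReal_nonneg
  set E : ℝ := (eLpNorm (u t₀) 2 volume).toReal with hE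
  have hE0 : 0 ≤ E := ENNReal.toReal_nonneg
  have hut₀ : MemLp (u t₀) 2 volume := hLH.memLp t₀ ⟨ht₀.1.le, ht₀.2.le⟩
  set Lr : ℝ := K * E ^ eκ with hLr
  have hLr0 : 0 ≤ Lr := by positivity
  have hTt : 0 < T - t₀ := sub_pos.2 ht₀.2
  -- the key claim: for every `ε > 0`, `1 ≤ q Lr (Y t₀ + ε)^q (T - t₀)`
  have hclaim : ∀ ε : ℝ, 0 < ε → 1 ≤ q * Lr * (Y t₀ + ε) ^ q * (T - t₀) := by
    intro ε hε
    by_contra hlt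
    push Not at hlt
    set A : ℝ := Y t₀ + ε with hA
    have hA0 : 0 < A := by have := hY0 t₀; linarith
    have hAq : 0 < A ^ q := Real.rpow_pos_of_pos hA0 _
    set θ : ℝ := 1 - q * Lr * A ^ q * (T - t₀) with hθ
    have hθ0 : 0 < θ := by linarith
    obtain ⟨b, hb, hMb⟩ := HighRows.exists_row_gt (κ := κ) (by linarith) hν hT hmax hLH ht₀.2 ((A ^ q / θ) ^ (1 / q))
    have hb1 : t₀ < b := (le_max_left t₀ 0).trans_lt hb.1
    have hbT : b < T := hb.2
    have hYc : ContinuousOn Y (Icc t₀ b) := HighRows.continuousOn_row (by linarith) hν hT hmax hLH ht₀.1 hb1.le hbT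
    set G : ℝ → ℝ := fun τ => Y (t₀ + τ) + ε with hG
    have hmaps : MapsTo (fun τ : ℝ => t₀ + τ) (Icc 0 (b - t₀)) (Icc t₀ b) := fun τ hτ =>
      ⟨by linarith [hτ.1], by linarith [hτ.2]⟩
    have hGc : ContinuousOn G (Icc 0 (b - t₀)) :=
      ((hYc.comp (continuous_const.add continuous_id).continuousOn hmaps).add continuousOn_const)
    have hG0 : ∀ τ ∈ Icc 0 (b - t₀), 0 ≤ G τ := fun τ _ => by have := hY0 (t₀ + τ); simp only [hG]; linarith
    have hpos : 0 < G 0 := by simp only [hG, add_zero]; exact hA0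
    have hGpc : ∀ b' ∈ Icc 0 (b - t₀), ContinuousOn (fun τ => G τ ^ (1 + q)) (uIcc 0 b') := fun b' hb' => by
      rw [uIcc_of_le hb'.1]
      exact (hGc.mono (Icc_subset_Icc le_rfl hb'.2)).rpow_const fun τ _ => Or.inr (by linarith)
    have hYpc : ∀ b' ∈ Icc 0 (b - t₀), ContinuousOn (fun τ => Y (t₀ + τ) ^ (1 + q)) (uIcc 0 b') := fun b' hb' => by
      rw [uIcc_of_le hb'.1]
      exact ((hYc.comp (continuous_const.add continuous_id).continuousOn hmaps).mono
        (Icc_subset_Icc le_rfl hb'.2)).rpow_const fun τ _ => Or.inr (by linarith)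
    have hineq : ∀ b' ∈ Icc 0 (b - t₀), G b' ≤ G 0 + Lr * ∫ τ in (0 : ℝ)..b', G τ ^ (1 + q) := by
      intro b' hb'
      have h2 := hRic ν T hν hT u p hmax hLH t₀ (t₀ + b') ht₀.1 (by linarith [hb'.1]) (by linarith [hb'.2])
      have hpw : 1 + 5 / (2 * κ) = 1 + q := by rw [hq]
      rw [hpw] at h2
      have hshift : ∫ τ in t₀..(t₀ + b'), Y τ ^ (1 + q) = ∫ τ in (0 : ℝ)..b', Y (t₀ + τ) ^ (1 + q) := by
        rw [intervalIntegral.integral_comp_add_left (fun τ => Y τ ^ (1 + q)) t₀, add_zero]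
      have hmono : ∫ τ in (0 : ℝ)..b', Y (t₀ + τ) ^ (1 + q) ≤ ∫ τ in (0 : ℝ)..b', G τ ^ (1 + q) := by
        refine intervalIntegral.integral_mono_on hb'.1 (hYpc b' hb').intervalIntegrable
          (hGpc b' hb').intervalIntegrable fun τ _ => ?_
        exact Real.rpow_le_rpow (hY0 _) (by simp only [hG]; linarith) (by linarith)
      have h3 : Y (t₀ + b') - Y t₀ ≤ Lr * ∫ τ in (0 : ℝ)..b', G τ ^ (1 + q) := by
        calc Y (t₀ + b') - Y t₀ ≤ K * E ^ eκ * ∫ τ in t₀..(t₀ + b'), Y τ ^ (1 + q) := h2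
          _ ≤ Lr * ∫ τ in (0 : ℝ)..b', G τ ^ (1 + q) := by
              rw [hshift, hLr]
              exact mul_le_mul_of_nonneg_left hmono hLr0
      simp only [hG, add_zero]
      linarith
    have hcomp := rpow_mul_le_of_rpow hLr0 (by linarith : 0 < b - t₀) hq0 hGc hG0 hpos hineq (b - t₀)
      ⟨by linarith, le_rfl⟩
    simp only [hG, add_zero, add_sub_cancel] at hcomp
    have hφ : θ ≤ 1 - q * Lr * (Y t₀ + ε) ^ q * (b - t₀) := by
      have : q * Lr * A ^ q * (b - t₀) ≤ q * Lr * A ^ q * (T - t₀) :=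
        mul_le_mul_of_nonneg_left (by linarith) (by positivity)
      rw [hθ, hA]; linarith
    have hYbε : 0 ≤ (Y b + ε) ^ q := Real.rpow_nonneg (by linarith [hY0 b]) _
    have h4 : (Y b + ε) ^ q * θ ≤ A ^ q := by
      calc (Y b + ε) ^ q * θ ≤ (Y b + ε) ^ q * (1 - q * Lr * (Y t₀ + ε) ^ q * (b - t₀)) :=
            mul_le_mul_of_nonneg_left hφ hYbε
        _ ≤ (Y t₀ + ε) ^ q := hcomp
        _ = A ^ q := rfl
    have h5 : (Y b + ε) ^ q ≤ A ^ q / θ := (le_div_iff₀ hθ0).2 h4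
    have h6 : Y b + ε ≤ (A ^ q / θ) ^ (1 / q) := by
      have h := Real.rpow_le_rpow hYbε h5 (by positivity : (0 : ℝ) ≤ 1 / q)
      rwa [← Real.rpow_mul (by linarith [hY0 b]), mul_one_div_cancel hq0.ne', Real.rpow_one] at h
    linarith
  -- let `ε → 0`
  have hmain : 1 ≤ q * Lr * Y t₀ ^ q * (T - t₀) := by
    by_contra hlt
    push Not at hlt
    have hcont : ContinuousAt (fun ε : ℝ => q * Lr * (Y t₀ + ε) ^ q * (T - t₀)) 0 := by
      have h1 : ContinuousAt (fun ε : ℝ => (Y t₀ + ε) ^ q) 0 :=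
        ((continuous_const.add continuous_id).continuousAt).rpow_const (Or.inr hq0.le)
      exact (continuousAt_const.mul h1).mul continuousAt_const
    have hev : ∀ᶠ ε in 𝓝[>] (0 : ℝ), q * Lr * (Y t₀ + ε) ^ q * (T - t₀) < 1 := by
      have h := (tendsto_order.1 hcont.tendsto).2 1 (by simpa using hlt)
      exact h.filter_mono nhdsWithin_le_nhds
    obtain ⟨ε, hε, hεpos⟩ := (hev.and self_mem_nhdsWithin).exists
    exact absurd (hclaim ε hεpos) (not_le.2 hε)
  -- `Lr > 0` (else the claim reads `1 ≤ 0`), hence `E > 0`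
  have hLrpos : 0 < Lr := by
    rcases hLr0.eq_or_lt with h | h
    · rw [← h] at hmain; norm_num at hmain
    · exact h
  have hEpos : 0 < E := by
    rcases hE0.eq_or_lt with h | h
    · exfalso
      rw [hLr, ← h, Real.zero_rpow heκ0.ne', mul_zero] at hLrpos
      exact lt_irrefl _ hLrpos
    · exact h
  -- conclude: `Y t₀ ≥ (q K E^{eκ} (T - t₀))^{-1/q}`
  have hYq : (q * Lr * (T - t₀))⁻¹ ≤ Y t₀ ^ q := by
    rw [inv_le_iff_one_le_mul₀ (by positivity)]
    calc (1 : ℝ) ≤ q * Lr * Y t₀ ^ q * (T - t₀) := hmain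
      _ = Y t₀ ^ q * (q * Lr * (T - t₀)) := by ring
  have hYt : (q * K) ^ (-(1 / q)) * E ^ (-((2 * κ - 10) / 5)) * (T - t₀) ^ (-(2 * κ / 5)) ≤ Y t₀ := by
    have h := Real.rpow_le_rpow (by positivity) hYq (by positivity : (0 : ℝ) ≤ 1 / q)
    rw [← Real.rpow_mul (hY0 t₀), mul_one_div_cancel hq0.ne', Real.rpow_one] at h
    refine le_trans (le_of_eq ?_) h
    have eX : q * Lr * (T - t₀) = (q * K) * (E ^ eκ * (T - t₀)) := by rw [hLr]; ring
    have hX0 : 0 ≤ (q * K) * (E ^ eκ * (T - t₀)) := by positivity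
    have e1 : eκ * -(1 / q) = -((2 * κ - 10) / 5) := by rw [← heq]; ring
    have e3 : (T - t₀) ^ (-(1 / q)) = (T - t₀) ^ (-(2 * κ / 5)) := by rw [hq1]
    have key : ((q * K) * (E ^ eκ * (T - t₀))) ^ (-(1 / q)) =
        (q * K) ^ (-(1 / q)) * E ^ (-((2 * κ - 10) / 5)) * (T - t₀) ^ (-(2 * κ / 5)) := by
      rw [Real.mul_rpow (by positivity) (by positivity), Real.mul_rpow (Real.rpow_nonneg hE0 _) hTt.le,
        ← Real.rpow_mul hE0, e1, e3]
      ring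
    rw [Real.inv_rpow (by positivity), eX, ← Real.rpow_neg hX0, key]
  -- multiply by `E^{(2κ−10)/5}` and pass to `ℝ≥0∞`
  have hreal : (q * K) ^ (-(1 / q)) * (T - t₀) ^ (-(2 * κ / 5)) ≤ E ^ ((2 * κ - 10) / 5) * Y t₀ := by
    have h := mul_le_mul_of_nonneg_left hYt (Real.rpow_nonneg hE0 ((2 * κ - 10) / 5))
    have hEE : E ^ ((2 * κ - 10) / 5) * E ^ (-((2 * κ - 10) / 5)) = 1 := by
      rw [Real.rpow_neg hE0, mul_inv_cancel₀ (Real.rpow_pos_of_pos hEpos _).ne']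
    calc (q * K) ^ (-(1 / q)) * (T - t₀) ^ (-(2 * κ / 5))
        = (E ^ ((2 * κ - 10) / 5) * E ^ (-((2 * κ - 10) / 5))) *
            ((q * K) ^ (-(1 / q)) * (T - t₀) ^ (-(2 * κ / 5))) := by rw [hEE, one_mul]
      _ = E ^ ((2 * κ - 10) / 5) * ((q * K) ^ (-(1 / q)) * E ^ (-((2 * κ - 10) / 5)) * (T - t₀) ^ (-(2 * κ / 5))) := by
          ring
      _ ≤ E ^ ((2 * κ - 10) / 5) * Y t₀ := h
  have hYtop : ∑' j : ℤ, (2 : ℝ≥0∞) ^ (κ * (j : ℝ)) * blockL2 (u t₀) j ^ 2 ≠ ∞ :=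
    HighRows.row_ne_top (by linarith) hν hT hmax hLH ht₀
  have hEe : ENNReal.ofReal (E ^ ((2 * κ - 10) / 5)) = eLpNorm (u t₀) 2 volume ^ ((2 * κ - 10) / 5) := by
    rw [hE, ENNReal.toReal_rpow, ENNReal.ofReal_toReal (ENNReal.rpow_ne_top_of_nonneg (by
      have : (0 : ℝ) ≤ (2 * κ - 10) / 5 := by linarith
      exact this) hut₀.eLpNorm_ne_top)]
  calc ENNReal.ofReal ((q * K) ^ (-(1 / q)) * (T - t₀) ^ (-(2 * κ / 5)))
      ≤ ENNReal.ofReal (E ^ ((2 * κ - 10) / 5) * Y t₀) := ENNReal.ofReal_le_ofReal hreal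
    _ = ENNReal.ofReal (E ^ ((2 * κ - 10) / 5)) * ENNReal.ofReal (Y t₀) := ENNReal.ofReal_mul (by positivity)
    _ = _ := by rw [hEe, hY, ENNReal.ofReal_toReal hYtop]

/-! ## L59 in the `Ḣ^s` currency, `s > 5/2` -/

/-- **L59 IN `Ḣ^s`, squared form.** For every `s > 5/2` there is `c = c_s > 0` such that along every maximal smooth
Leray–Hopf solution of the unforced system (`ν > 0`), at EVERY `t ∈ (0, T)`:
`c · (T − t)^{−4s/5} ≤ ‖u(t)‖₂^{(4s−10)/5} · ‖u(t)‖²_{Ḣ^s}` (`row_clock_high` at `κ = 2s` read through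
`∑_j 4^{sj}a_j² ≤ 8·4^s ‖u‖²_{Ḣ^s}`, `HomSobolev32Clock.tsum_weight_blockL2_sq_le`). [cite: RobinsonSadowskiSilva2012, §VI (6.1)] -/
theorem homSobolev_clock_high_sq (s : ℝ) (hs : 5 / 2 < s) :
    ∃ c : ℝ, 0 < c ∧ ∀ (ν T : ℝ), 0 < ν → 0 < T →
      ∀ (u : ℝ → EuclideanSpace ℝ (Fin 3) → EuclideanSpace ℝ (Fin 3)) (p : ℝ → EuclideanSpace ℝ (Fin 3) → ℝ),
      IsMaximalSmoothSolution ν 0 u p T → IsLerayHopfOn T ν 0 (u 0) u →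
      ∀ t ∈ Ioo 0 T,
        ENNReal.ofReal (c * (T - t) ^ (-(4 * s / 5))) ≤
          eLpNorm (u t) 2 volume ^ ((4 * s - 10) / 5) *
            Function.eHomSobolevSeminorm s (⇑EuclideanSpace.complexify ∘ u t) ^ 2 := by
  obtain ⟨c, hc, H⟩ := row_clock_high (κ := 2 * s) (by linarith)
  set M : ℝ := 8 * (2 : ℝ) ^ (2 * s) with hM
  have hM0 : 0 < M := by positivity
  have hMe : (8 : ℝ≥0∞) * (2 : ℝ≥0∞) ^ |2 * s| = ENNReal.ofReal M := by
    rw [abs_of_pos (by linarith), hM, ENNReal.ofReal_mul (by norm_num), ← ENNReal.ofReal_rpow_of_pos two_pos,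
      ENNReal.ofReal_ofNat, ENNReal.ofReal_ofNat]
  refine ⟨c / M, by positivity, fun ν T hν hT u p hmax hLH t ht => ?_⟩
  have hTt : 0 < T - t := sub_pos.2 ht.2
  have hut : MemLp (u t) 2 volume := hLH.memLp t ⟨ht.1.le, ht.2.le⟩
  have h1 := H ν T hν hT u p hmax hLH t ht
  have e1 : 2 * (2 * s) / 5 = 4 * s / 5 := by ring
  have e2 : (2 * (2 * s) - 10) / 5 = (4 * s - 10) / 5 := by ring
  rw [e1, e2] at h1
  have h2 := tsum_weight_blockL2_sq_le s hut
  rw [hMe] at h2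
  set Ee : ℝ≥0∞ := eLpNorm (u t) 2 volume ^ ((4 * s - 10) / 5) with hEe
  have h3 : ENNReal.ofReal (c * (T - t) ^ (-(4 * s / 5))) ≤
      Ee * (ENNReal.ofReal M * Function.eHomSobolevSeminorm s (⇑EuclideanSpace.complexify ∘ u t) ^ 2) :=
    h1.trans (mul_le_mul' le_rfl h2)
  have e : c / M * (T - t) ^ (-(4 * s / 5)) = M⁻¹ * (c * (T - t) ^ (-(4 * s / 5))) := by field_simp
  rw [e, ENNReal.ofReal_mul (by positivity), ENNReal.ofReal_inv_of_pos hM0]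
  have hMne : ENNReal.ofReal M ≠ 0 := by rwa [ne_eq, ENNReal.ofReal_eq_zero, not_le]
  calc (ENNReal.ofReal M)⁻¹ * ENNReal.ofReal (c * (T - t) ^ (-(4 * s / 5)))
      ≤ (ENNReal.ofReal M)⁻¹ * (Ee * (ENNReal.ofReal M * Function.eHomSobolevSeminorm s (⇑EuclideanSpace.complexify ∘ u t) ^ 2)) :=
        mul_le_mul' le_rfl h3
    _ = Ee * Function.eHomSobolevSeminorm s (⇑EuclideanSpace.complexify ∘ u t) ^ 2 := by
        rw [mul_left_comm Ee, ← mul_assoc, ENNReal.inv_mul_cancel hMne ENNReal.ofReal_ne_top, one_mul]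

/-- **L59 — ROBINSON–SADOWSKI–SILVA'S RATE ABOVE `5/2`, VERBATIM AND VISCOSITY-FREE: for every `s > 5/2` there is
`c = c_s > 0` such that for every `ν > 0`, `T > 0`, every maximal smooth solution `(u, p)` of the unforced Navier–Stokes
system on `ℝ³ × [0, T)` which is Leray–Hopf from `u 0`, and EVERY `t ∈ (0, T)`:
`c · (T − t)^{−2s/5} ≤ ‖u(t)‖₂^{(2s−5)/5} · ‖u(t)‖_{Ḣ^s}`**, i.e. `‖u(t)‖_{Ḣ^s} ≥ c_s ‖u(t)‖_{L²}^{(5−2s)/5} (T − t)^{−2s/5}`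
(their (6.1); the `L²` factor has a negative power and the energy decays, so it only helps). The exponent `2s/5`
SUPERSEDES Benameur's `s/3` (L54-H) for every `s > 5/2` and meets the optimal `(2s−1)/4` (L52/L57/L58) at `s = 5/2`;
the constant involves NO viscosity — the one Euler-strength row of the dictionary. Necessity only; not claimed optimal.
[cite: RobinsonSadowskiSilva2012, §VI (6.1)] [cite: Benameur2010, Thm. 1.1] -/
theorem homSobolev_clock_high (s : ℝ) (hs : 5 / 2 < s) :
    ∃ c : ℝ, 0 < c ∧ ∀ (ν T : ℝ), 0 < ν → 0 < T →
      ∀ (u : ℝ → EuclideanSpace ℝ (Fin 3) → EuclideanSpace ℝ (Fin 3)) (p : ℝ → EuclideanSpace ℝ (Fin 3) → ℝ),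
      IsMaximalSmoothSolution ν 0 u p T → IsLerayHopfOn T ν 0 (u 0) u →
      ∀ t ∈ Ioo 0 T,
        ENNReal.ofReal (c * (T - t) ^ (-(2 * s / 5))) ≤
          eLpNorm (u t) 2 volume ^ ((2 * s - 5) / 5) *
            Function.eHomSobolevSeminorm s (⇑EuclideanSpace.complexify ∘ u t) := by
  obtain ⟨c, hc, H⟩ := homSobolev_clock_high_sq s hs
  refine ⟨c ^ (1 / 2 : ℝ), by positivity, fun ν T hν hT u p hmax hLH t ht => ?_⟩
  have hTt : 0 < T - t := sub_pos.2 ht.2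
  have h := H ν T hν hT u p hmax hLH t ht
  have hA : 0 ≤ c * (T - t) ^ (-(4 * s / 5)) := by positivity
  have h' := ENNReal.rpow_le_rpow h (by norm_num : (0 : ℝ) ≤ 1 / 2)
  have hX : (eLpNorm (u t) 2 volume ^ ((4 * s - 10) / 5) *
      Function.eHomSobolevSeminorm s (⇑EuclideanSpace.complexify ∘ u t) ^ 2) ^ (1 / 2 : ℝ) =
      eLpNorm (u t) 2 volume ^ ((2 * s - 5) / 5) * Function.eHomSobolevSeminorm s (⇑EuclideanSpace.complexify ∘ u t) := by
    rw [ENNReal.mul_rpow_of_nonneg _ _ (by norm_num : (0 : ℝ) ≤ 1 / 2), ← ENNReal.rpow_mul,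
      ← ENNReal.rpow_natCast, ← ENNReal.rpow_mul]
    norm_num
    congr 1
    ring_nf
  rw [hX, ENNReal.ofReal_rpow_of_nonneg hA (by norm_num)] at h'
  refine le_trans (le_of_eq ?_) h'
  congr 1
  rw [Real.mul_rpow hc.le (Real.rpow_nonneg hTt.le _), ← Real.rpow_mul hTt.le]
  congr 2
  ring

/-- **L59 WITH THE DATUM'S ENERGY.** For every `s > 5/2`, with the constant `c_s` of `homSobolev_clock_high`: along
every maximal smooth Leray–Hopf solution of the unforced system (`ν > 0`), at EVERY `t ∈ (0, T)`:
`c_s · (T − t)^{−2s/5} ≤ ‖u(0)‖₂^{(2s−5)/5} · ‖u(t)‖_{Ḣ^s}` (Leray's energy inequality `‖u(t)‖₂ ≤ ‖u(0)‖₂`; the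
exponent `(2s−5)/5` is positive). [cite: RobinsonSadowskiSilva2012, §VI (6.1)] [cite: Leray1934, §19 p. 224] -/
theorem homSobolev_clock_high_datum (s : ℝ) (hs : 5 / 2 < s) {ν T : ℝ} (hν : 0 < ν) (hT : 0 < T)
    {u : ℝ → EuclideanSpace ℝ (Fin 3) → EuclideanSpace ℝ (Fin 3)} {p : ℝ → EuclideanSpace ℝ (Fin 3) → ℝ}
    (hmax : IsMaximalSmoothSolution ν 0 u p T) (hLH : IsLerayHopfOn T ν 0 (u 0) u) {t : ℝ} (ht : t ∈ Ioo 0 T) :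
    ENNReal.ofReal ((homSobolev_clock_high s hs).choose * (T - t) ^ (-(2 * s / 5))) ≤
      eLpNorm (u 0) 2 volume ^ ((2 * s - 5) / 5) *
        Function.eHomSobolevSeminorm s (⇑EuclideanSpace.complexify ∘ u t) := by
  have h := (homSobolev_clock_high s hs).choose_spec.2 ν T hν hT u p hmax hLH t ht
  refine h.trans (mul_le_mul' (ENNReal.rpow_le_rpow ?_ (by linarith)) le_rfl)
  exact hLH.eLpNorm_le_eLpNorm_datum hν.le (hLH.memLp 0 ⟨le_rfl, hT.le⟩) ⟨ht.1.le, ht.2.le⟩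

/-! ## The interface reading -/

/-- **L59 READ ON THE INTERFACE: every cascade witness blows up in every `Ḣ^s`, `s > 5/2`, at least at the rate
`2s/5`.** Every `W : CascadeWitness` yields `ν > 0`, `T > 0` and a maximal smooth solution `(u, p)` of the unforced
Navier–Stokes system on `ℝ³ × [0, T)`, Leray–Hopf from `u 0` (`x5a_of_cascadeWitness'`), such that for every `s > 5/2`,
with the constant `c_s` of `homSobolev_clock_high`: `c_s (T − t)^{−2s/5} ≤ ‖u(0)‖₂^{(2s−5)/5} ‖u(t)‖_{Ḣ^s}` at every
`t ∈ (0, T)`. [cite: RobinsonSadowskiSilva2012, §VI (6.1)] -/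
theorem homSobolev_clock_high_of_cascadeWitness (W : CascadeWitness) :
    ∃ ν : ℝ, 0 < ν ∧ ∃ T : ℝ, 0 < T ∧
      ∃ (u : ℝ → EuclideanSpace ℝ (Fin 3) → EuclideanSpace ℝ (Fin 3)) (p : ℝ → EuclideanSpace ℝ (Fin 3) → ℝ),
        IsMaximalSmoothSolution ν 0 u p T ∧ IsLerayHopfOn T ν 0 (u 0) u ∧
        ∀ s : ℝ, ∀ hs : 5 / 2 < s, ∀ t ∈ Ioo 0 T,
          ENNReal.ofReal ((homSobolev_clock_high s hs).choose * (T - t) ^ (-(2 * s / 5))) ≤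
            eLpNorm (u 0) 2 volume ^ ((2 * s - 5) / 5) *
              Function.eHomSobolevSeminorm s (⇑EuclideanSpace.complexify ∘ u t) := by
  obtain ⟨ν, hν, T, hT, u, p, hmax, hLH, -⟩ := x5a_of_cascadeWitness' W
  exact ⟨ν, hν, T, hT, u, p, hmax, hLH, fun s hs t ht => homSobolev_clock_high_datum s hs hν hT hmax hLH ht⟩

end Summit.NavierStokesRegularity.FluidComputer.EulerRateClock

end
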